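import Literature.NumberTheory.EllipticCurves.Sprung2012.ColemanMapLambdaActionProofs
import Summits.BirchSwinnertonDyer.Rank1Residual.Supersingular.BlindPointDerivAt
import HarnessLib

/-!
# Route `ByReductionTypeAtTwo` (rung K4), crux `SupersingularRankZeroAtTwo` (item stmt-BirchSwinnertonDyer-19097):
# the LOCAL TRANSVERSALITY CRITERION behind stub 5 `stub_CD` (CDF `FlatBlindControlFiniteAtTwo`) of the
# registered line `Cruxes/SupersingularRankZeroAtTwo/Lines/odd_blind_package.lean` v2.4 (6b3a2105f6bed8e6)
# — Sprung's Coleman characterisation READ AT THE BLIND CHARACTER `ψ₂` (`γ ↦ −1`, `T = −2`)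
# (seat `bsd-2adic-ss-1`, GEN 18, LEAD attack (L2) on CDF)

HONEST FRAMING (cell `bsd-2adic`, run/shared/lean/pub/bsd-2adic/): THEOREMS ONLY; no definition, no named
fact, no `sorry`, no instance; pure algebra inside the tree's transcription of Sprung 2012
(`Sprung2012/ColemanMaps.lean`: `H¹_Iw(T)` = additive functionals `z` on `E(K_∞·K_v)`, `Col(z) = (L♯, L♭)` iff
`IsColemanPair`, kernels `colemanKer`). Nothing about any curve's Selmer group is asserted; nothing booked
(D-0054); BSD is not proved by any of this. PARTITION: X5@2 good-ss r₀ block × p = 2 — types-the-object-of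
(isolates the LOCAL content of CDF as one statement about the joint Coleman image at `T = −2`); closes none.
bears_on: K4 (route-BirchSwinnertonDyer-ByReductionTypeAtTwo item 19097).

## The mathematics (`p = 2`; levels `0` and `1` of Def. 5.9 read at `T = −2`)

At `p = 2` — and only there — `ω₁ = (1+T)² − 1 = T·(T+2)` vanishes at the blind point `T = −2`
(`toIwasawa_cyclotomicOmega_one_two`), so the LEVEL-ONE clause of the Coleman characterisation
`ω₁ ∣ P_{1,c₁}(z) + u₁·L♯ + v₁·L♭` with `u₁ = 1`, `v₁ = 0` (Sprung 2017 Cor. 4.4; tree `sharpPoly_one`,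
`flatPoly_one`) reads, after evaluating at `−2` (`P_{1,c₁}(z)(−2) = z(c₁) − z(g c₁)`):

* **`L♯(z)(−2) = z(g·c₁) − z(c₁)`** for EVERY functional `z` (`evalAt_negTwo_sharp_of_isColemanPair`): the ♯
  value at the blind character is SEEN at layer one — it is the evaluation of `z` at the `ψ₂`-vector
  `(g − 1)·c₁ ∈ E(K₁·K_v)` — while `L♭(z)(−2)` is constrained by NO finite-level clause (the ♭ colour is
  BLIND at `−2`: `v₁ = 0`, and `v_m(−2) = 0` for all `m ≥ 1`, tree `eval_neg_two_flatPoly`).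
* Hence **`Ker Col♯` annihilates `(g − 1)·c₁`** (`apply_smul_eq_of_mem_colemanKer_sharp`): dually, the
  Kummer line of the `ψ₂`-vector lies inside the ♯ local condition `E^♯ = Ann(Ker Col♯)` — the algebraic
  shadow of the forced zero `L♯(−2) = 0` on the odd-twist half (line file, CDF docstring; tree
  `tsum_sharp_neg_two_eq_zero`): ♯ is NEVER transverse at `ψ₂`.
* **Transversality of ♭ at `ψ₂` ⟺ the ideal `Col♯(Ker Col♭) ⊄ (T+2)`** (`exists_mem_colemanKer_flat_apply_ne_iff`):
  some `z ∈ Ker Col♭` does NOT kill `(g−1)·c₁` iff some Coleman value `(a, 0)` has `a(−2) ≠ 0`.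
* **Wronskian criterion** (`exists_mem_colemanKer_flat_apply_ne_of_wronskian`, the `T = −2` twin of the tree's
  `T = 0` cokernel criterion `IsColemanPair.forall_exists_isColemanPair_X_mul_of_det`): if two functionals
  `z₀, z₁` have Coleman values `(a₀, b₀)`, `(a₁, b₁)` whose Wronskian `a₀b₁ − a₁b₀` does not vanish at `−2`,
  then `z := b₁•z₀ − b₀•z₁` (`Λ`-linearity of `Col`, `IsColemanPair.exists_mul`) lies in `Ker Col♭` and
  `z((g−1)c₁) = (a₀b₁ − a₁b₀)(−2) ≠ 0`.  Equivalently: the joint image `Col(H¹_Iw) ⊆ Λ²` reduced modulo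
  `(T+2)` has `ℤ₂`-rank 2 (at `T = 0` it has rank 1 — the Kurihara–Pollack cokernel `ℤ_p` sits at the
  TRIVIAL character; whether anything sits at `ψ₂` is exactly the local content of CDF).

WHY THIS IS THE LOCAL CONTENT OF CDF (memo `HOME/ss/gen18/CDF-ATTACK-GEN18.md`): `Sel♭_∞[γ+1]` is cut, at
the prime over `2`, by `L♭_ψ = E^♭ ∩ (E(ℚ_{∞,2}) ⊗ ℚ₂/ℤ₂)[γ+1] = Ann(Ker Col♭ + (T+2)·H¹_Iw)`; the Kummer line of
the rank-one twist `E^{(2)}` at `2` is `K_ψ = (E(ℚ₂(√2))^{ψ₂}) ⊗ ℚ₂/ℤ₂ = Ann(Ann((g−1)c₁))` up to finite index;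
`L♭_ψ ∩ K_ψ` is finite iff `Ker Col♭ ⊄ Ann((g−1)c₁)` — the statement decided here by a Wronskian value. The
remaining (global) half of CDF is inflation–restriction (`E(ℚ_∞)[2] = 0`: tree
`SignedTransportAtTwo.fixedPoints_kerSubgroup_eq_bot_of_goodSS`) + Poitou–Tate for `E^{(2)}` relaxed/strict at `2`.
In print every image/surjectivity statement for `Col` is `p` odd (Sprung 2012 §7; Kurihara–Pollack 2007
Prop. 1.2 at `a_p = 0`); the `p = 2` Wronskian value is NOT in print — it is the honest residual, one `2`-adic
statement per local type `a₂ ∈ {−2, 0, 2}` (Honda: the formal group at `2` is determined by `a₂`).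

## References
* [Sprung2012] F. E. I. Sprung, J. Number Theory 132 (2012) 1483–1506: Def. 3.1 (p. 1489), Def. 5.9 (p. 1495),
  Def. 7.1–7.2 and Prop. 7.3 (p. 1500), Def. 7.9 (p. 1503).
* [Sprung2017] F. Sprung, ANT 11 (2017), Cor. 4.4 (`u₁ = 1`, `v₁ = 0`).
* [KuriharaPollack2007] M. Kurihara, R. Pollack, Prop. 1.2 (the cokernel `ℤ_p` at the trivial character, `a_p = 0`).
* [MazurTateTeitelbaum1986Invent] §I.14 (the point `T = −2` at `p = 2`).
* Tree: `Sprung2012/{ColemanMaps, ColemanTwistProofs, ColemanMapLambdaActionProofs, ColemanMapJointCokernelProofs}.lean`,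
  `Rank1Residual/Supersingular/{BlindPointLever, BlindPointDerivAt}.lean` (`BlindLever.evalAt`).
-/

set_option autoImplicit false
set_option linter.dupNamespace false

noncomputable section

open scoped Classical

open Polynomial

universe u

namespace Summit.BirchSwinnertonDyer.BirchSwinnertonDyer.Theorems

namespace OddBlindLocal

open Literature.NumberTheory.EllipticCurves Literature.NumberTheory.GaloisRepresentations ZpExtension
  Literature.NumberTheory.EllipticCurves.Kobayashi2003 Literature.NumberTheory.EllipticCurves.Sprung2017
  Literature.NumberTheory.EllipticCurves.Sprung2012
  Summit.BirchSwinnertonDyer.Rank1Residual.Supersingular.BlindLever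

/-! ## §0 `ω₁ = T·(T+2)` at `p = 2`: the blind character is a zero of `ω₁` -/

/-- **`ω₁ = (1+T)² − 1 = T·(T + 2)` in `Λ₂ = ℤ₂⟦T⟧`** — at `p = 2` the first cyclotomic layer polynomial
vanishes at the blind point `T = −2` (the order-2 character `γ ↦ −1` of `Γ ≅ ℤ₂`).
[cite: MazurTateTeitelbaum1986Invent, §I.14 (the point T = −2)] -/
theorem toIwasawa_cyclotomicOmega_one_two :
    toIwasawa 2 (cyclotomicOmega 2 1) = PowerSeries.X * (PowerSeries.X + PowerSeries.C (2 : ℤ_[2])) := by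
  rw [toIwasawa_cyclotomicOmega, pow_one]
  have h2 : (PowerSeries.C (2 : ℤ_[2]) : PowerSeries ℤ_[2]) = 2 := map_ofNat _ 2
  rw [h2]
  ring

/-- `ω₁(−2) = 0` in `ℤ₂`. [cite: MazurTateTeitelbaum1986Invent, §I.14] -/
theorem evalAt_negTwo_toIwasawa_cyclotomicOmega_one :
    evalAt (-2 : ℤ_[2]) (toIwasawa 2 (cyclotomicOmega 2 1)) = 0 := by
  rw [toIwasawa_cyclotomicOmega_one_two, evalAt_mul norm_neg_two_lt_one, evalAt_X, evalAt_add norm_neg_two_lt_one,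
    evalAt_X, evalAt_C]
  ring

/-- Anything divisible by `ω₁` vanishes at `−2`. [cite: MazurTateTeitelbaum1986Invent, §I.14] -/
theorem evalAt_negTwo_eq_zero_of_omega_one_dvd {F : IwasawaAlgebra 2}
    (h : toIwasawa 2 (cyclotomicOmega 2 1) ∣ F) : evalAt (-2 : ℤ_[2]) F = 0 := by
  obtain ⟨q, rfl⟩ := h
  rw [evalAt_mul norm_neg_two_lt_one, evalAt_negTwo_toIwasawa_cyclotomicOmega_one, zero_mul]

/-! ## §1 Level one of the Coleman characterisation read at `T = −2` -/

section Local

variable {K : Type u} [Field K] (κ : ZpExtension K 2)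
variable {E : Type u} [Field E] [Algebra K E] (ι : AlgebraicClosure K →ₐ[K] AlgebraicClosure E)
variable (W : WeierstrassCurve K)

/-- **`P_{1,x}(z)(−2) = z(x) − z(g·x)`**: the level-one orbit sum `z(x) + z(gx)·(1+T)` at the blind point.
[cite: Sprung2012, Def. 3.1 (p. 1489)] -/
theorem evalAt_negTwo_pairingSum_one (A : AddSubgroup (localPoints W E)) (g : Field.absoluteGaloisGroup E)
    (x : localPoints W E) (z : A →+ ℤ_[2]) :
    evalAt (-2 : ℤ_[2]) (pairingSum W A g 1 x z) = evalOn W A z x - evalOn W A z (g • x) := by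
  rw [pairingSum_def, pow_one, Finset.sum_range_succ, Finset.sum_range_succ, Finset.sum_range_zero, zero_add,
    pow_zero, pow_zero, one_smul, mul_one, pow_one, pow_one, evalAt_add norm_neg_two_lt_one, evalAt_C,
    evalAt_mul norm_neg_two_lt_one, evalAt_C, evalAt_add norm_neg_two_lt_one, evalAt_one, evalAt_X]
  ring

variable {κ ι W}

/-- ★ **`L♯(z)(−2) = z(g·c₁) − z(c₁)` for EVERY Coleman pair** (`p = 2`): level `1` of Def. 5.9,
`ω₁ ∣ P_{1,c₁}(z) + u₁L♯ + v₁L♭` with `u₁ = 1`, `v₁ = 0` (Sprung 2017 Cor. 4.4), evaluated at the zero `−2`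
of `ω₁`.  The ♯ value at the blind character is SEEN at layer one (it is `z` at the `ψ₂`-vector `(g−1)c₁`);
the ♭ value at `−2` enters no finite-level clause.  No hypothesis on `(ap, g, c)` is needed.
[cite: Sprung2012, Def. 5.9 (p. 1495) and Def. 7.2 (p. 1500)] [cite: Sprung2017, Cor. 4.4] -/
theorem evalAt_negTwo_sharp_of_isColemanPair {ap : ℤ} {g : Field.absoluteGaloisGroup E} {c : ℕ → localPoints W E}
    {z : localTowerPointsOfEmb κ ι W →+ ℤ_[2]} {Ls Lf : IwasawaAlgebra 2}
    (h : IsColemanPair κ ι W ap g c z Ls Lf) :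
    evalAt (-2 : ℤ_[2]) Ls =
      evalOn W (localTowerPointsOfEmb κ ι W) z (g • c 1) - evalOn W (localTowerPointsOfEmb κ ι W) z (c 1) := by
  have h1 := evalAt_negTwo_eq_zero_of_omega_one_dvd (h 1)
  rw [sharpPoly_one, flatPoly_one, map_one, map_zero, one_mul, zero_mul, add_zero,
    evalAt_add norm_neg_two_lt_one, evalAt_negTwo_pairingSum_one] at h1
  linear_combination h1

/-- With `c₁` in the tower (e.g. `c₁ ∈ E(K₁·K_v)`), the same identity with `z` applied to genuine elements of
`E(K_∞·K_v)`. [cite: Sprung2012, Def. 5.9 (p. 1495) and Def. 7.2 (p. 1500)] -/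
theorem evalAt_negTwo_sharp_of_isColemanPair_of_mem {ap : ℤ} {g : Field.absoluteGaloisGroup E}
    {c : ℕ → localPoints W E} (hc1 : c 1 ∈ localTowerPointsOfEmb κ ι W)
    {z : localTowerPointsOfEmb κ ι W →+ ℤ_[2]} {Ls Lf : IwasawaAlgebra 2}
    (h : IsColemanPair κ ι W ap g c z Ls Lf) :
    evalAt (-2 : ℤ_[2]) Ls =
      z ⟨g • c 1, smul_mem_localTowerPointsOfEmb κ ι W g hc1⟩ - z ⟨c 1, hc1⟩ := by
  rw [evalAt_negTwo_sharp_of_isColemanPair h, evalOn_of_mem W _ z (smul_mem_localTowerPointsOfEmb κ ι W g hc1),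
    evalOn_of_mem W _ z hc1]

/-! ## §2 ♯ is never transverse at `ψ₂`: `Ker Col♯` annihilates the `ψ₂`-vector `(g − 1)·c₁` -/

/-- ★ **Every `z ∈ Ker Col♯` satisfies `z(g·c₁) = z(c₁)`** (`p = 2`): `Col♯(z) = 0` forces `L♯(z)(−2) = 0`.
Dually (Def. 7.9: `E^♯ = Ann(Ker Col♯)`), the Kummer line of the `ψ₂`-vector `(g−1)c₁` lies in the ♯ local
condition — the algebraic shadow of the forced zero `L♯(−2) = 0` on the odd-twist half; so ♯ can never be
the transverse colour at `ψ₂`. [cite: Sprung2012, Def. 7.9 (p. 1503) and Def. 5.9 (p. 1495)] -/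
theorem apply_smul_eq_of_mem_colemanKer_sharp {ap : ℤ} {g : Field.absoluteGaloisGroup E}
    {c : ℕ → localPoints W E} {z : localTowerPointsOfEmb κ ι W →+ ℤ_[2]}
    (hz : z ∈ colemanKer κ ι W ap g c .sharp) :
    evalOn W (localTowerPointsOfEmb κ ι W) z (g • c 1) = evalOn W (localTowerPointsOfEmb κ ι W) z (c 1) := by
  obtain ⟨Ls, Lf, hCP, h0⟩ := hz
  rw [chromaticL_sharp] at h0
  have h := evalAt_negTwo_sharp_of_isColemanPair hCP
  rw [h0, evalAt_zero] at h
  linear_combination -h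

/-! ## §3 ♭ transversality at `ψ₂` ⟺ a Coleman value `(a, 0)` with `a(−2) ≠ 0` -/

/-- ★ **CRITERION.**  Some `z ∈ Ker Col♭` does not kill the `ψ₂`-vector `(g−1)·c₁` iff some functional has a
Coleman value `(a, 0)` with `a(−2) ≠ 0` — i.e. iff the ideal `Col♯(Ker Col♭) ⊆ Λ₂` is not contained in the
prime `(T + 2)`.  (Left to right: the pair of `z` is `(a, 0)` and `a(−2) = z(gc₁) − z(c₁)`; right to left: that
functional is in `Ker Col♭`.) [cite: Sprung2012, Def. 7.9 (p. 1503) and Def. 5.9 (p. 1495)] -/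
theorem exists_mem_colemanKer_flat_apply_ne_iff {ap : ℤ} {g : Field.absoluteGaloisGroup E}
    {c : ℕ → localPoints W E} :
    (∃ z ∈ colemanKer κ ι W ap g c .flat,
        evalOn W (localTowerPointsOfEmb κ ι W) z (g • c 1) ≠ evalOn W (localTowerPointsOfEmb κ ι W) z (c 1)) ↔
      ∃ (z : localTowerPointsOfEmb κ ι W →+ ℤ_[2]) (a : IwasawaAlgebra 2),
        IsColemanPair κ ι W ap g c z a 0 ∧ evalAt (-2 : ℤ_[2]) a ≠ 0 := by
  constructor
  · rintro ⟨z, ⟨Ls, Lf, hCP, h0⟩, hne⟩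
    rw [chromaticL_flat] at h0
    subst h0
    refine ⟨z, Ls, hCP, ?_⟩
    rw [evalAt_negTwo_sharp_of_isColemanPair hCP]
    exact sub_ne_zero.mpr hne
  · rintro ⟨z, a, hCP, hne⟩
    refine ⟨z, ⟨a, 0, hCP, by rw [chromaticL_flat]⟩, ?_⟩
    rw [evalAt_negTwo_sharp_of_isColemanPair hCP] at hne
    exact fun h ↦ hne (sub_eq_zero.mpr h)

/-- ★★ **WRONSKIAN CRITERION FOR ♭-TRANSVERSALITY AT `ψ₂`** (the `T = −2` twin of the tree's `T = 0` cokernel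
criterion).  If two functionals `z₀, z₁` on `E(K_∞·K_v)` have Coleman values `(a₀, b₀)`, `(a₁, b₁)` (points
`c_n` of level `n`, `g` a local lift of the topological generator) and the Wronskian `a₀b₁ − a₁b₀` does NOT
vanish at `T = −2`, then some `z ∈ Ker Col♭` has `z(g·c₁) ≠ z(c₁)`: take `z = b₁•z₀ − b₀•z₁` (`Λ`-linearity,
`IsColemanPair.exists_mul`), whose Coleman value is `(a₀b₁ − a₁b₀, 0)`.  Equivalently the joint image
`Col(H¹_Iw) mod (T+2)` has `ℤ₂`-rank `2`. [cite: Sprung2012, Def. 5.9 (p. 1495), Def. 7.9 (p. 1503) and §2 p. 1486 (Λ-linearity)] -/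
theorem exists_mem_colemanKer_flat_apply_ne_of_wronskian {ap : ℤ} {g : Field.absoluteGaloisGroup E}
    (hg : κ.IsTopGenerator (resGalOfEmb ι g)) {c : ℕ → localPoints W E}
    (hc : ∀ n, c n ∈ localLayerPointsOfEmb κ ι W n)
    {z₀ z₁ : localTowerPointsOfEmb κ ι W →+ ℤ_[2]} {a₀ b₀ a₁ b₁ : IwasawaAlgebra 2}
    (h₀ : IsColemanPair κ ι W ap g c z₀ a₀ b₀) (h₁ : IsColemanPair κ ι W ap g c z₁ a₁ b₁)
    (hW : evalAt (-2 : ℤ_[2]) (a₀ * b₁ - a₁ * b₀) ≠ 0) :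
    ∃ z ∈ colemanKer κ ι W ap g c .flat,
      evalOn W (localTowerPointsOfEmb κ ι W) z (g • c 1) ≠ evalOn W (localTowerPointsOfEmb κ ι W) z (c 1) := by
  obtain ⟨w₀, hw₀⟩ := h₀.exists_mul hg hc b₁
  obtain ⟨w₁, hw₁⟩ := h₁.exists_mul hg hc b₀
  have hz : IsColemanPair κ ι W ap g c (w₀ - w₁) (b₁ * a₀ - b₀ * a₁) (b₁ * b₀ - b₀ * b₁) := hw₀.sub hw₁
  have hb : b₁ * b₀ - b₀ * b₁ = 0 := by ring
  rw [hb] at hz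
  refine (exists_mem_colemanKer_flat_apply_ne_iff).mpr ⟨w₀ - w₁, b₁ * a₀ - b₀ * a₁, hz, ?_⟩
  have e : b₁ * a₀ - b₀ * a₁ = a₀ * b₁ - a₁ * b₀ := by ring
  rwa [e]

/-- **Conversely, a transverse ♭ kernel element and ANY functional seeing `c₀` give a Wronskian non-zero at
`−2`** — so (granted one functional `z₁` with `L♭(z₁)(−2) ≠ 0`) the two formulations are equivalent.  Here in
the weaker, hypothesis-explicit form: if `z₀ ∈ Ker Col♭` has value `(a₀, 0)` with `a₀(−2) ≠ 0` and `z₁` has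
value `(a₁, b₁)` with `b₁(−2) ≠ 0`, the Wronskian `a₀b₁ − a₁·0` does not vanish at `−2` (`ℤ₂` is a domain).
[cite: Sprung2012, Def. 5.9 (p. 1495)] -/
theorem evalAt_negTwo_wronskian_ne_zero {a₀ a₁ b₁ : IwasawaAlgebra 2}
    (ha : evalAt (-2 : ℤ_[2]) a₀ ≠ 0) (hb : evalAt (-2 : ℤ_[2]) b₁ ≠ 0) :
    evalAt (-2 : ℤ_[2]) (a₀ * b₁ - a₁ * 0) ≠ 0 := by
  rw [mul_zero, sub_zero, evalAt_mul norm_neg_two_lt_one]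
  exact mul_ne_zero ha hb

/-! ## §4 The level-zero reading: `Ker Col♭` annihilates `c₀` (for contrast: ♭ is SEEN at the trivial character) -/

/-- **Every `z ∈ Ker Col♭` satisfies `z(c₀) = 0`**: level `0` of Def. 5.9 reads `T ∣ z(c₀) + u₀L♯ + v₀L♭ =
z(c₀) + L♭` (`u₀ = 0`, `v₀ = 1`), so `L♭(z)(0) = −z(c₀)` and `Col♭(z) = 0` forces `z(c₀) = 0` — at the TRIVIAL
character ♭ is the seen colour and ♯ the blind one (`u₀ = 0`), the mirror image of §1–§2.
[cite: Sprung2012, Def. 7.2 (p. 1500: Col♭_0 = −P_{0,c_0}) and Def. 7.9 (p. 1503)] -/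
theorem apply_eq_zero_of_mem_colemanKer_flat {ap : ℤ} {g : Field.absoluteGaloisGroup E}
    {c : ℕ → localPoints W E} {z : localTowerPointsOfEmb κ ι W →+ ℤ_[2]}
    (hz : z ∈ colemanKer κ ι W ap g c .flat) :
    evalOn W (localTowerPointsOfEmb κ ι W) z (c 0) = 0 := by
  obtain ⟨Ls, Lf, hCP, h0⟩ := hz
  rw [chromaticL_flat] at h0
  subst h0
  have h := hCP 0
  rw [sharpPoly_zero, flatPoly_zero, map_zero, map_one, zero_mul, mul_zero, add_zero, add_zero,
    pairingSum_def, pow_zero, Finset.sum_range_one, pow_zero, pow_zero, one_smul, mul_one,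
    toIwasawa_cyclotomicOmega, pow_zero, pow_one, add_sub_cancel_left] at h
  -- `X ∣ C (z c₀)` forces `z(c₀) = 0`
  have hc := PowerSeries.X_dvd_iff.mp h
  rwa [PowerSeries.constantCoeff_C] at hc

end Local

end OddBlindLocal

end Summit.BirchSwinnertonDyer.BirchSwinnertonDyer.Theorems

end
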